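import Summits.CriticalPhenomena.PercolationContinuityZ3.Theorems.SahiMasterFamilyGSystems

/-!
# The G-system conjecture `(GH)_k` (= Sahi's `C_k` on the principal-cap stratum) and the union-closed-polytope conjecture, typed;
# `(GH)_k` for `k ≤ 7`, `F(k) ⇒ (GH)_k`, `(UC-hull)_k ⇒ (GH)_k`

Unit `prim-masterthm-p4` (gen 15; crux anchor stmt-CriticalPhenomena-4575, helper work; memo
`run/shared/lean/prim/prim-masterthm/prim-masterthm-p4/P4-GEN15-REPORT.md` §2, §8).  Companion of `…GSystems` (G-system moments lie in `X_k` and in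
the one-missing-face cone; `(GH)_k` for `k ≤ 7` with hypotheses inline) and `…PrincipalCapBeta` (`PhiNonneg`, refuted from `k = 16` in `…PhiSymmetricLift`).

Two conjecture-valued definitions (never facts), recording the all-`k` targets that replace the refuted relaxation `F(k)`:
* `GSystemNonneg k` — **(GH)_k**: every NORMALISED G-SYSTEM (increasing events `G_S`, `G_S ∩ G_T ⊆ G_{S∪T}`, `G_univ = everything`) on every finite product
  space has `Φ_k(S ↦ μ_p(G_S)) ≥ 0`.  Paper (memo §2): `(GH)_k ⟺` Sahi's `C_k` on the principal-cap stratum (PC families induce G-systems with the same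
  conditional moments; every normalised G-system is an `η → 0` limit of PC families).  Kernel: `gSystemNonneg_of_le_seven` (`3 ≤ k ≤ 7`),
  `gSystemNonneg_of_phiNonneg` (`F(k) ⇒ (GH)_k`).
* `UCHullNonneg k` — **(UC-hull)_k**: `Φ_k ≥ 0` at every finite MIXTURE `β = Σ_x w_x 1_{𝒰_x}` of union-closed families `𝒰_x ∋ univ` (weights `w_x ≥ 0`,
  `Σ w_x = 1`); NOT contained in `F(k)` (mixtures need not be supermultiplicative); evidence k ≤ 8 (memo §8); `gSystemNonneg_of_ucHullNonneg`:
  `(UC-hull)_k ⇒ (GH)_k` (a G-system's moment function is the mixture over `ω` of the indicators of `𝒢(ω) = {S : ω ∈ G_S}`).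
HONEST FRAMING: both OPEN for `k ≥ 8`; Sahi's `C_k`, Kahn's Conjecture 5 and the master theorem remain OPEN.  Axioms standard. [this work]
-/

noncomputable section

open scoped Classical

namespace Summit.CriticalPhenomena.PercolationContinuityZ3.Theorems

namespace GHConjecture

open Finset
open Literature.Combinatorics.Sahi2008
open Literature.Probability.Percolation.DecisionTree (ind ind_of_mem ind_of_not_mem ind_nonneg)
open PrincipalCapBeta (phiSet)

/-- **`(GH)_k`** — Sahi nonnegativity for normalised G-systems on finite product spaces (`⟺` Sahi's `C_k` on the principal-cap stratum, memo §2).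
A conjecture-valued definition, never a fact. [this work] [status: open for k ≥ 8; true for k ≤ 7] -/
@[conjecture] def GSystemNonneg (k : ℕ) : Prop :=
  ∀ (ι : Type) [Fintype ι] (p : ι → unitInterval) (G : Finset (Fin k) → Set (Set ι)),
    (∀ S, IsUpperSet (G S)) → (∀ S T, G S ∩ G T ⊆ G (S ∪ T)) → G univ = Set.univ →
      0 ≤ phiSet k (fun S => ex (bernoulliWeight p) (ind (G S)))

/-- **`(UC-hull)_k`** — Sahi nonnegativity on the normalised union-closed polytope: every finite mixture of indicator functions of union-closed
families containing `univ` has `Φ_k ≥ 0`.  A conjecture-valued definition, never a fact. [this work] [status: open; numerically clean k ≤ 8] -/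
@[conjecture] def UCHullNonneg (k : ℕ) : Prop :=
  ∀ (α : Type) [Fintype α] (w : α → ℝ) (𝒰 : α → Finset (Finset (Fin k))),
    (∀ x, 0 ≤ w x) → ∑ x, w x = 1 → (∀ x, ∀ A ∈ 𝒰 x, ∀ A' ∈ 𝒰 x, A ∪ A' ∈ 𝒰 x) → (∀ x, univ ∈ 𝒰 x) →
      0 ≤ phiSet k (fun S => ∑ x, w x * (if S ∈ 𝒰 x then (1 : ℝ) else 0))

variable {k : ℕ}

/-- `(GH)_k` for `3 ≤ k ≤ 7` (from `GSystems.phiSet_gsystem_nonneg_of_le_seven`, i.e. the kernel theorems `F(3),…,F(7)`). [this work] -/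
theorem gSystemNonneg_of_le_seven (h3 : 3 ≤ k) (h7 : k ≤ 7) : GSystemNonneg k :=
  fun _ _ p G hup hG htop => GSystems.phiSet_gsystem_nonneg_of_le_seven h3 h7 p G hup hG htop

/-- `F(k) ⇒ (GH)_k` (vacuous for `k ≥ 16`, where `F(k)` is false). [this work] -/
theorem gSystemNonneg_of_phiNonneg (h : PrincipalCapBeta.PhiNonneg k) : GSystemNonneg k :=
  fun _ _ p G hup hG htop => GSystems.phiSet_gsystem_nonneg_of_phiNonneg h p G hup hG htop

/-- **`(UC-hull)_k ⇒ (GH)_k`**: the moment function of a G-system is the `μ_p`-mixture of the indicators of the union-closed families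
`𝒢(ω) = {S : ω ∈ G_S}`. [this work] -/
theorem gSystemNonneg_of_ucHullNonneg (h : UCHullNonneg k) : GSystemNonneg k := by
  intro ι _ p G hup hG htop
  set 𝒢 : Set ι → Finset (Finset (Fin k)) := fun ω => univ.filter fun S => ω ∈ G S with h𝒢
  have hUC : ∀ ω, ∀ A ∈ 𝒢 ω, ∀ A' ∈ 𝒢 ω, A ∪ A' ∈ 𝒢 ω := by
    intro ω A hA A' hA'
    simp only [h𝒢, mem_filter, mem_univ, true_and] at hA hA' ⊢
    exact hG A A' ⟨hA, hA'⟩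
  have htopmem : ∀ ω, univ ∈ 𝒢 ω := fun ω => by
    simp only [h𝒢, mem_filter, mem_univ, true_and, htop, Set.mem_univ]
  have hβ : (fun S => ex (bernoulliWeight p) (ind (G S))) =
      fun S => ∑ ω, bernoulliWeight p ω * (if S ∈ 𝒢 ω then (1 : ℝ) else 0) := by
    funext S
    rw [ex_def]
    refine sum_congr rfl fun ω _ => ?_
    by_cases hω : ω ∈ G S
    · rw [ind_of_mem hω, if_pos (by simp only [h𝒢, mem_filter, mem_univ, true_and]; exact hω)]
    · rw [ind_of_not_mem hω, if_neg (by simp only [h𝒢, mem_filter, mem_univ, true_and]; exact hω)]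
  rw [hβ]
  exact h (Set ι) (bernoulliWeight p) 𝒢 (fun ω => (isFKGMeasure_bernoulliWeight p).nonneg ω)
    (isFKGMeasure_bernoulliWeight p).sum_eq_one hUC htopmem

/-- **`(UC-hull)_3` holds** — indeed `Φ_3 ≥ 0` on the whole box `0 ≤ β ≤ 1`, `β_univ = 1` (`2 − Σβ_i + ∏β_i = (1−β₀)(1−β₁) + (1−β₂)(1−β₀β₁)`, the argument of
`PrincipalCapBeta.phiNonneg_three`, which never uses supermultiplicativity); `k = 4` is the first order where union-closure matters. [this work] -/
theorem ucHullNonneg_three : UCHullNonneg 3 := by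
  intro α _ w 𝒰 hw0 hw1 _ htop
  set β : Finset (Fin 3) → ℝ := fun S => ∑ x, w x * (if S ∈ 𝒰 x then (1 : ℝ) else 0) with hβ
  have h0 : ∀ B, 0 ≤ β B := fun B => sum_nonneg fun x _ => mul_nonneg (hw0 x) (by split_ifs <;> norm_num)
  have h1 : ∀ B, β B ≤ 1 := fun B => by
    calc β B ≤ ∑ x, w x * 1 := sum_le_sum fun x _ => mul_le_mul_of_nonneg_left (by split_ifs <;> norm_num) (hw0 x)
      _ = 1 := by rw [← sum_mul, hw1, one_mul]
  have huniv : β univ = 1 := by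
    have : ∀ x, w x * (if (univ : Finset (Fin 3)) ∈ 𝒰 x then (1 : ℝ) else 0) = w x := fun x => by rw [if_pos (htop x), mul_one]
    simp only [hβ, this, hw1]
  show 0 ≤ phiSet 3 β
  rw [PrincipalCapBeta.phiSet_three, huniv]
  have a0 := h0 {0}; have a1 := h0 {1}; have a2 := h0 {2}
  have b0 := h1 {0}; have b1 := h1 {1}; have b2 := h1 {2}
  have c0 : β {0} * β {1, 2} ≤ β {0} := by nlinarith [h1 {1, 2}, h0 {1, 2}]
  have c1 : β {1} * β {0, 2} ≤ β {1} := by nlinarith [h1 {0, 2}, h0 {0, 2}]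
  have c2 : β {2} * β {0, 1} ≤ β {2} := by nlinarith [h1 {0, 1}, h0 {0, 1}]
  have t1 : 0 ≤ (1 - β {0}) * (1 - β {1}) := mul_nonneg (sub_nonneg.2 b0) (sub_nonneg.2 b1)
  have t2 : 0 ≤ (1 - β {2}) * (1 - β {0} * β {1}) :=
    mul_nonneg (sub_nonneg.2 b2) (sub_nonneg.2 (mul_le_one₀ b0 a1 b1))
  nlinarith [t1, t2, c0, c1, c2]

end GHConjecture

end Summit.CriticalPhenomena.PercolationContinuityZ3.Theorems
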